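import Mathlib
import HarnessLib
import Summits.NavierStokesRegularity.NavierStokesRegularity.Theorems.TaylorModelRungThreeCertificateReadoutVState
import Summits.NavierStokesRegularity.NavierStokesRegularity.Theorems.TaylorModelRungThreeCertificateReadoutVInStep
import Summits.NavierStokesRegularity.NavierStokesRegularity.Theorems.TaylorModelRungThreeCertificateReadoutVLandD
import Summits.NavierStokesRegularity.NavierStokesRegularity.Theorems.TaylorModelRungThreeCertificateFormatVNode

/-!
# Crux K1b-DR (stmt-NavierStokesRegularity-23954), line `taylor-model` — v3 read-outs, K-SIDE part 4: the per-stage READ-OUT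
# STEP `readoutStep : ROIn → ROOut` (typer g32) — the data flow of the last sub-step's read-outs in ONE kernel, in the pattern of
# `coreStep : CoreIn → CoreOut` (the composer, engine-1 g67, fills `ROIn` from its `nodeVW/coreVW/stageV/base.stage` accessors)

Given the record `ROIn` (kit; the last sub-step's centre `x`, length `h`, hull boxes `H2 ⊇ H1 ⊇ H0` at node `S−1` and `Ha1` at node
`S`, the core outputs `J`, `JU`, the node frame `Vc`, `B`, `[Z]`; the section covector box `Wσ` and scalar boxes `lev ∈ LB`, `γ ∈ GB`,
`as ∈ ASB`, `Λδτs·ω(−Kb) ∈ AK`, the behind-shell surrogate `rlo`; the landing data `Lv ∈ LvB`, tail bound `tv`, faces `WJ` of the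
target ball with `ctrB/radB/sB`, the emitted `βB`, partner rows `G` with radii `rPB`, and the polytope box radii `ρ`):

  `Min := inStepM H2 h JU ωinvB` (in-step kernels over `u ∈ [0,h]`),  `TP := coreTP x [0,h]`,
  `Y_l := inStepY TP J h Min H_l x` (l = 0, 1: the in-step boxes = `ro.ylo/yhi`),
  `VB := Min · (Vc ⊕ B·[Z])` (`= [ro.Vlo, ro.Vhi]`, (R10) by construction),  `F := qBboxMA(Y1, Y1)`,
  `ok := testR5 ∧ testR7 ∧ testR8 ∧ landOK Y0 ∧ testR9 (landBox of Y0) ∧ testR11`.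

This file: `IntervalD.pointIM` (+ `memMat_pointIM`), `ROIn`, `ROOut`, `CertTables.readoutStep`, the named intermediates
`ROIn.Min/TP/Y0/Y1/VB/F` with `rfl` projections (`readoutStep_ok/Y0/Y1/VB`), and `inStepM_memMat` (coordinate form of
`inStepM_kernel`). Soundness corollaries per clause: `…ReadoutVStepSound`.

HONEST FRAMING: kernel bookkeeping for the MODEL certificate №23954 (rung TL-M3); nothing here is a statement about the
Navier–Stokes equations.
-/

-- the sub-problem namespace repeats the summit name by design (D-0017)
set_option linter.dupNamespace false

namespace Summit.NavierStokesRegularity.NavierStokesRegularity.Theorems.TaylorModelCert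

open scoped BigOperators
open Set
open Literature.Analysis.FluidPDE.TaoCascade Literature.Analysis.FluidPDE.TaoCascade.TaylorChain
open Summit.NavierStokesRegularity.NavierStokesRegularity.Theorems.TaylorModelReadout (varJet)
open Summit.NavierStokesRegularity.NavierStokesRegularity.Theorems.TaylorModelV (basisSt)

namespace IntervalD

/-- A dyadic point matrix as an interval matrix. [folklore] -/
def pointIM (n : ℕ) (X : Array (Array Dyad)) : Array (Array IntervalD) :=
  Array.ofFn fun r : Fin n => Array.ofFn fun c : Fin n => ofDyad (dmget X r c)

/-- [folklore] -/
theorem memMat_pointIM (n : ℕ) (X : Array (Array Dyad)) : MemMat n (dre X) (pointIM n X) := by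
  intro r hr c hc
  simp only [pointIM, imget_ofFn_row _ c hr, aget_ofFn _ hc, dre]
  exact mem_ofDyad _

end IntervalD

/-- **Read-out step INPUT** of a stage (see the module docstring for the meaning of each field). [folklore] -/
structure ROIn where
  /-- coefficient boxes of the field twin -/
  coefB : Fin 4 → Fin 4 → Fin 4 → ℕ → ℤ → IntervalD
  /-- active-monomial table (`= T.monosTable coefB`) -/
  mt : Array (List (ℕ × ℕ × ℕ))
  /-- precision, Taylor order, variational order -/
  (prec p pV : ℕ)
  /-- centre and length of the last sub-step -/
  (x : Array Dyad) (h : Dyad)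
  /-- hull boxes at node `S−1` (outer, level 0, level 1) and the level-1 hull box at node `S` -/
  (H2 H0 H1 Ha1 : Array IntervalD)
  /-- core outputs of the last sub-step: jet tail and variational tail bounds -/
  (J JU : Array Dyad)
  /-- enclosures of `ω_k⁻¹` per coordinate -/
  ωinvB : Array IntervalD
  /-- node `S−1` frame: `Vc`, `B` (point dyadics) and `[Z]` -/
  (Vc B : Array (Array Dyad))
  Z : Array (Array IntervalD)
  /-- section covector coefficient boxes; `lev`, `γ`, `as`, `Λδτs·ω(−Kb)` boxes; behind-shell surrogate -/
  Wσ : Array IntervalD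
  (LB GB ASB AK : IntervalD)
  rlo : Dyad
  /-- landing: `Lv` box, tail bound, number of faces, face coefficient boxes of the target ball, partner rows -/
  LvB : IntervalD
  tv : Dyad
  nF : ℕ
  (WJ G : Array (Array IntervalD))
  /-- `ctr/rad/s` of the target ball, emitted `β` of this stage, partner radii; polytope box radii -/
  (ctrB radB sB βB rPB : Array IntervalD)
  ρ : Array Dyad

/-- **Read-out step OUTPUT**: verdict, the in-step boxes `Y0`, `Y1`, the derivative kernel box `VB`. [folklore] -/
structure ROOut where
  ok : Bool
  (Y0 Y1 : Array IntervalD)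
  VB : Array (Array IntervalD)

namespace ROIn

variable {K : Type} [Field K] (T : CertTables K) (ri : ROIn)

/-- In-step kernel box of the last sub-step. [folklore] -/
def Min : Array (Array IntervalD) := T.inStepM ri.coefB ri.prec ri.pV ri.H2 ri.h ri.JU ri.ωinvB

/-- Centre Taylor polynomial over `u ∈ [0,h]`. [folklore] -/
def TP : Array IntervalD := T.coreTP ri.coefB ri.mt ri.prec ri.p ri.x ⟨Dyad.ofInt 0, ri.h⟩

/-- Level-0 in-step box. [folklore] -/
def Y0 : Array IntervalD := T.inStepY ri.prec ri.p (ri.TP T) ri.J ri.h (ri.Min T) ri.H0 ri.x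

/-- Level-1 in-step box. [folklore] -/
def Y1 : Array IntervalD := T.inStepY ri.prec ri.p (ri.TP T) ri.J ri.h (ri.Min T) ri.H1 ri.x

/-- Derivative kernel box `Min · (Vc ⊕ B·[Z])`. [folklore] -/
def VB : Array (Array IntervalD) :=
  mulII T.n ri.prec (ri.Min T) (addIM T.n ri.prec (IntervalD.pointIM T.n ri.Vc) (mulDI T.n ri.prec ri.B ri.Z))

/-- Field box over the level-1 in-step box. [folklore] -/
def F : Array IntervalD := T.qBboxMA ri.coefB ri.prec ri.mt (ri.Y1 T) (ri.Y1 T)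

end ROIn

namespace CertTables

variable {K : Type} [Field K]

/-- **The read-out step** (one stage, last sub-step). [folklore] -/
def readoutStep (T : CertTables K) (ri : ROIn) : ROOut :=
  { ok := T.testR5 ri.prec ri.Wσ ri.LB ri.H1 ri.Ha1 && T.testR7 ri.coefB ri.prec ri.mt ri.Wσ ri.GB (ri.Y1 T) &&
          T.testR8 ri.ASB ri.AK ri.rlo (ri.Y1 T) && T.landOK (ri.Y0 T) &&
          T.testR9 ri.prec ri.nF ri.WJ (T.landBox ri.prec ri.LvB ri.tv (ri.Y0 T)) ri.ctrB ri.βB ri.sB ri.radB &&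
          T.testR11 ri.prec ri.nF ri.WJ ri.G ri.rPB ri.βB ri.ρ ri.LvB ri.tv (ri.Y1 T) ri.Wσ (ri.F T) (ri.VB T)
    Y0 := ri.Y0 T, Y1 := ri.Y1 T, VB := ri.VB T }

variable (T : CertTables K) (ri : ROIn)

omit [Field K] in
/-- [folklore] -/
theorem readoutStep_Y0 : (T.readoutStep ri).Y0 = ri.Y0 T := rfl
omit [Field K] in
/-- [folklore] -/
theorem readoutStep_Y1 : (T.readoutStep ri).Y1 = ri.Y1 T := rfl
omit [Field K] in
/-- [folklore] -/
theorem readoutStep_VB : (T.readoutStep ri).VB = ri.VB T := rfl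

omit [Field K] in
/-- The verdict unfolds to the five tests. [folklore] -/
theorem readoutStep_ok (h : (T.readoutStep ri).ok = true) :
    T.testR5 ri.prec ri.Wσ ri.LB ri.H1 ri.Ha1 = true ∧ T.testR7 ri.coefB ri.prec ri.mt ri.Wσ ri.GB (ri.Y1 T) = true ∧
    T.testR8 ri.ASB ri.AK ri.rlo (ri.Y1 T) = true ∧ T.landOK (ri.Y0 T) = true ∧
    T.testR9 ri.prec ri.nF ri.WJ (T.landBox ri.prec ri.LvB ri.tv (ri.Y0 T)) ri.ctrB ri.βB ri.sB ri.radB = true ∧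
    T.testR11 ri.prec ri.nF ri.WJ ri.G ri.rPB ri.βB ri.ρ ri.LvB ri.tv (ri.Y1 T) ri.Wσ (ri.F T) (ri.VB T) = true := by
  have h' : (T.testR5 ri.prec ri.Wσ ri.LB ri.H1 ri.Ha1 && T.testR7 ri.coefB ri.prec ri.mt ri.Wσ ri.GB (ri.Y1 T) &&
      T.testR8 ri.ASB ri.AK ri.rlo (ri.Y1 T) && T.landOK (ri.Y0 T) &&
      T.testR9 ri.prec ri.nF ri.WJ (T.landBox ri.prec ri.LvB ri.tv (ri.Y0 T)) ri.ctrB ri.βB ri.sB ri.radB &&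
      T.testR11 ri.prec ri.nF ri.WJ ri.G ri.rPB ri.βB ri.ρ ri.LvB ri.tv (ri.Y1 T) ri.Wσ (ri.F T) (ri.VB T)) = true := h
  simp only [Bool.and_eq_true] at h'
  obtain ⟨⟨⟨⟨⟨h5, h7⟩, h8⟩, hL⟩, h9⟩, h11⟩ := h'
  exact ⟨h5, h7, h8, hL, h9, h11⟩

omit [Field K] in
/-- [folklore] -/
theorem size_Y1 : (ri.Y1 T).size = T.n := by simp only [ROIn.Y1, inStepY, Array.size_ofFn]

omit [Field K] in
/-- [folklore] -/
theorem size_Y0 : (ri.Y0 T).size = T.n := by simp only [ROIn.Y0, inStepY, Array.size_ofFn]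

/-- **Coordinate form of `inStepM_kernel`**: an in-step kernel (window form of `InStepKer`, `u ∈ [0,h]`) lies in `Min` as a
coordinate matrix `(r, c) ↦ A (wi r) (wk r) (wi c) (wk c)` (`= matOfKer A`). [folklore] -/
theorem inStepM_memMat {φ : K →+* ℝ} (hco : T.CoefOK φ) {coefB : Fin 4 → Fin 4 → Fin 4 → ℕ → ℤ → IntervalD}
    (hcB : CoefBoxOK φ T coefB) (prec pV : ℕ) {H2 : Array IntervalD} (hH2 : H2.size = T.n)
    {h : Dyad} {u : ℝ} (hu0 : 0 ≤ u) (huh : u ≤ h.toReal) (JU : Array Dyad)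
    {ω : ℤ → ℝ} {ωinvB : Array IntervalD} (hω : ∀ i k, -T.Kb ≤ k → k ≤ T.Ka → IntervalD.mem ((ω k)⁻¹) (IntervalD.aget ωinvB (T.idx i k)))
    {A : Fin 4 → ℤ → Fin 4 → ℤ → ℝ}
    (hA : ∀ i' k', -T.Kb ≤ k' → k' ≤ T.Ka → ∀ i k, -T.Kb ≤ k → k ≤ T.Ka →
      ∃ ζ : Fin 4 → ℤ → ℝ, T.InBoxW (T.vecF (IntervalD.loR H2)) (T.vecF (IntervalD.hiR H2)) ζ ∧
        |A i' k' i k - ∑ n ∈ Finset.range (pV + 1), varJet (T.toCertData φ).Qb ζ (basisSt i k) n i' k' * u ^ n|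
          ≤ T.vecF (vre JU) i' k' * (ω k)⁻¹ * u ^ (pV + 1)) :
    MemMat T.n (fun r c => A (T.wi r) (T.wk r) (T.wi c) (T.wk c)) (T.inStepM coefB prec pV H2 h JU ωinvB) := by
  intro r hr c hc
  have hkr := T.InW_wk hr
  have hkc := T.InW_wk hc
  have hm := T.inStepM_kernel hco hcB prec pV hH2 hu0 huh JU hω hA (T.wi r) hkr.1 hkr.2 (T.wi c) hkc.1 hkc.2
  rw [T.idx_wi_wk hr, T.idx_wi_wk hc] at hm
  exact hm

end CertTables

end Summit.NavierStokesRegularity.NavierStokesRegularity.Theorems.TaylorModelCert
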